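import Summits.QuantumFields.YangMills.Theorems.BalabanUVNodesN15TwoSpacingGluingNeumannKnitEntryOne
import Summits.QuantumFields.YangMills.Theorems.BalabanUVNodesN15TwoSpacingGluingRecordKnitRightRemainder
import Summits.QuantumFields.YangMills.Theorems.BalabanUVNodesN15TwoSpacingGluingNeumannKnitDefectRecordRows
import HarnessLib

/-!
# THE GLUING STEP AT TWO LATTICE SPACINGS, LXVI: THE «∇G» ENTRY OF THE RECORD COVER's PARAMETRIX — `∇_μ G̃ ≤ A·e^{−δ|y−y′|_T}` on the torus of record, any spacing, VOLUME FREE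
# (dag-n15-c g14, FILE 109 = 84R; N15 = NE2, s1 «background-layer OPERATOR ingredient»)

Cell `pub-ymgap`, seat `pub-ymgap-dag-n15-c` (R134 (a); HUMAN RULING D-0062), generation 14.  `bears_on: R4∕N15 · K3⁸ SpineGivenEndpointR13SepCoPHV (stmt-QuantumFields-27366)`.
Filed `--supports stmt-QuantumFields-27366 --as helper` — COUNT-NEUTRAL.  Theorems only (0 `def`, 0 `sorry`).  Imports BY NAME FILE 84 `…NeumannKnitEntryOne` (`coverH_shift_cut`; through it
FILE 83 `hasMaj_comp_parametrix_cut`, FILE 65 `fgrad_hcube_cut`, FILE 67 letters, FILE 72 `chiCube_coverCorner_eq_one_side` ∕ `sum_ind_cubeBlocks_le_overlap`, dag-n15-a N-IIc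
`hasMaj_chiCube_grad_neumannCubeG_fine`) and FILE 104 `…RecordKnitRightRemainder` (FILE 73 `knitGR` ∕ `knitHR` ∕ `MP_eq_two_mul` ∕ `coverMargin_fit`, programme P: P-IIb `liftCubeG_eq_liftOp` ∕
`comp_liftOp_of_comm` ∕ `symbOp_sD_comp_pullVR` ∕ `mulOp_chiCube_comp_liftOp`, P-IId `hasMaj_transplant_cube_family_spacing` ∕ `hasMaj_chiCube_liftCubeG_fine`) and the g12 record rows
`…NeumannKnitDefectRecordRows` (`liftCubeG_grad_row_fine`, the lifted fine `χ_□∘∇∘G^{↑}` row, reused BY NAME); nothing in the tree is modified.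

WHAT.  ★★ **`hasMaj_grad_parametrix_knitR`** — the record twin of FILE 84 `hasMaj_grad_parametrix_knit`: for odd `L ≥ 3`, `a > 0` there are `δ, A > 0` such that for all `s`, `m_T ≥ s + 1`, `K ≥ 1`, `r`,
`μ`, on `MP (paramsOf d L m_T K hL)` with FILE 73's cover, `∇_μ ∘ G̃ ≤ A·e^{−δ|y−y′|_T}` at the spacing `L^{−(K+r)}` (`r = 0`: the coarse one) — row 3∕10 of FILE 50's `GluedLetters` ON THE TORUS
OF RECORD, `A, δ` free of `s`, of the volume `m_T`, of `K`, of `r`: FILE 83's engine with the TRUE overlap `(L+1)^{d+1}`, P-IId's fine cut rows and the lifted `χ_□∘∇∘G^{↑}` rows.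

HONEST FRAMING ∕ LIMITS.  Block-majorant bookkeeping over LANDED rows; `U ≡ 1` MODEL of [B6] §2's machine on the torus of record (cube letters from each cube's own doubled torus via programme
P: not circular in the volume); constants crude and ours; nothing of [B5]∕[B6] (2.38)–(2.40)∕[B9] Thm 3.1, 3.14 asserted.  NE2⁺ NOT PRINTED, NOT proved; N15 NOT discharged; counts of record
UNMOVED (typed 28∕28 · discharged 5∕27); one finite 𝕋⁴ at fixed ε per index — NOT infinite volume, NOT OS on ℝ⁴, NOT a mass gap, NOT Clay; R4 closes `BalabanLadder.UV` only.  Restate-immune.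
-/

noncomputable section

namespace Summit.QuantumFields.YangMills.BalabanUVNodes.N15.Gluing

open Real
open Literature.MathematicalPhysics.QuantumFieldTheory.Balaban1983to89
open Literature.MathematicalPhysics.QuantumFieldTheory.Balaban1983to89.B5Prop11Plancherel (Tor fine)
open Literature.MathematicalPhysics.QuantumFieldTheory.Balaban1983to89.B11SectG (BlockNorm HasMaj RowSum)
open Literature.MathematicalPhysics.QuantumFieldTheory.Balaban1983to89.T4EtaRateDefect (idef)
open Literature.MathematicalPhysics.QuantumFieldTheory.Balaban1983to89.T4EtaRateCoeffDefect (pull)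
open Literature.MathematicalPhysics.QuantumFieldTheory.Balaban1983to89.B6Prop26Gluing (mulOp mulOp_apply ind ind_nonneg ind_le_one)
open Literature.MathematicalPhysics.QuantumFieldTheory.Balaban1983to89.B6UnitTorusCarrier (unitTorusGeo)
open Literature.MathematicalPhysics.QuantumFieldTheory.Balaban1983to89.B5SiteBridgeP12 (MP)
open Literature.MathematicalPhysics.QuantumFieldTheory.King1986.Torus (blockOf tdistT tdistT_nonneg)
open Summit.QuantumFields.YangMills.BalabanUVNodes.N15.VectorPiece (bshiftEquiv kingPrV blkFine)
open Summit.QuantumFields.YangMills.BalabanUVNodes.N15.BackgroundLayer (fgrad fgrad_apply symbOp_sD_eq)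
open Summit.QuantumFields.YangMills.BalabanUVNodes.N15.TwoGrid (paramsOf deltaOp gOp neumannCubeG chiCube cubeBlocks symbOp sD liftCubeG liftOp MP_dvd_MP torRed liftCubeG_eq_liftOp
  comp_liftOp_of_comm symbOp_sD_comp_pullVR mulOp_chiCube_comp_liftOp hasMaj_transplant_cube_family_spacing hasMaj_chiCube_liftCubeG_fine hasMaj_chiCube_grad_neumannCubeG_fine)

variable {d : ℕ}

section Record

variable {L : ℕ} [NeZero L]

/-- ★★ **THE ENTRY «∇G» OF THE RECORD COVER's PARAMETRIX, VOLUME FREE** — the record twin of FILE 84 `hasMaj_grad_parametrix_knit`: for odd `L ≥ 3`, `a > 0` there are `δ, A > 0` such that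
for all `s`, `m_T ≥ s + 1`, `K ≥ 1`, `r`, `μ`, on `MP (paramsOf d L m_T K hL)` with FILE 73's cover (`knitGR`: LIFTED Neumann cubes of side `L^{s+1}`; `knitHR`),
`∇_μ ∘ G̃ ≤ A·e^{−δ|y−y′|_T}` at the spacing `L^{−(K+r)}` — FILE 83 `hasMaj_comp_parametrix_cut` with P-IId's fine cut rows, the lifted fine `χ_□∘∇∘G^{↑}` rows, `|h_k| ≤ 1`, `|∇h_k| ≤ π∕L^s ≤ π`,
FILE 84's shifted cut, FILE 65's cut of `∇h_k`, and the TRUE overlap `(L+1)^{d+1}` (FILE 72) — `A, δ` free of `s, m_T, K, r`. [cite: Balaban1984PropagatorsII, (2.91)–(2.93) p.239, (2.133), (2.136)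
p.247 (shapes + mechanism); Balaban1984PropagatorsI, Prop. 1.2 (1.110) p.35] -/
theorem hasMaj_grad_parametrix_knitR (hL : Odd L ∧ 1 < L) {a : ℝ} (ha : 0 < a) :
    ∃ δ A : ℝ, 0 < δ ∧ 0 < A ∧ ∀ (s mT K r : ℕ) (hs : s + 1 ≤ mT) (_hK : 1 ≤ K) (μ : Fin (d + 1)),
      HasMaj (BlockNorm.ofBlocks (unitTorusGeo L K (MP (paramsOf d L mT K hL)))
          (fun i : Tor (fine (L ^ r * L ^ K) (MP (paramsOf d L mT K hL))) × Fin (d + 1) => blockOf (L ^ r * L ^ K) (MP (paramsOf d L mT K hL)) i.1))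
        (BlockNorm.ofBlocks (unitTorusGeo L K (MP (paramsOf d L mT K hL)))
          (fun i : Tor (fine (L ^ r * L ^ K) (MP (paramsOf d L mT K hL))) × Fin (d + 1) => blockOf (L ^ r * L ^ K) (MP (paramsOf d L mT K hL)) i.1))
        (fgrad ((L ^ r * L ^ K : ℕ) : ℝ) (bshiftEquiv (MP (paramsOf d L mT K hL)) (L ^ r * L ^ K) μ) ∘ₗ
          parametrix (knitHR d L s mT K (L ^ r * L ^ K) hL) (knitGR d L s mT K (L ^ r * L ^ K) hL hs a))
        (fun y y' => A * Real.exp (-(δ * tdistT (MP (paramsOf d L mT K hL)) y y'))) := by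
  have hL3 : 3 ≤ L := by obtain ⟨⟨j, hj⟩, h1⟩ := hL; omega
  have hLpos : 0 < L := by omega
  obtain ⟨δ₀, C, hδ₀, hC, HG'⟩ := hasMaj_chiCube_liftCubeG_fine (d := d) hL ha
  obtain ⟨δD, βD, hδD, hβD, HD⟩ := liftCubeG_grad_row_fine (d := d) hL ha
  set δ : ℝ := min δ₀ δD with hδ_def
  have hδ : 0 < δ := lt_min hδ₀ hδD
  set Nov : ℝ := (((L + 1) ^ (d + 1) : ℕ) : ℝ) with hNov_def
  refine ⟨δ, Nov * (1 * βD + π * C) + 1, hδ, by positivity, fun s mT K r hs hK μ => ?_⟩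
  set M : Fin (d + 1) → ℕ := MP (paramsOf d L mT K hL) with hMdef
  have hs' : s ≤ mT := by omega
  have hM : ∀ ν, M ν = 2 * L ^ (mT - s) * L ^ s := MP_eq_two_mul L s mT K hL hs'
  have hw : 0 < L ^ s := pow_pos hLpos s
  have hfit := coverMargin_fit hL3 s
  have hSe : L ^ (s + 1) = L * L ^ s := by rw [pow_succ, mul_comm]
  have hfit1 : coverMargin L s + 2 * L ^ s + 1 ≤ L ^ (s + 1) := by rw [hSe]; omega
  have hS : L ^ (s + 1) ≤ 2 * L ^ (mT - s) * L ^ s := by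
    calc L ^ (s + 1) ≤ L ^ mT := Nat.pow_le_pow_right hLpos hs
      _ = L ^ (mT - s) * L ^ s := by rw [← pow_add]; congr 1; omega
      _ ≤ 2 * L ^ (mT - s) * L ^ s := by rw [mul_assoc]; omega
  have hdiv : L ^ (s + 1) / L ^ s + 1 = L + 1 := by rw [hSe, Nat.mul_div_cancel _ hw]
  have hwR : (1 : ℝ) ≤ ((L ^ s : ℕ) : ℝ) := by exact_mod_cast hw
  have hind : ∀ (k : Fin (d + 1) → ZMod (2 * L ^ (mT - s))) (y y' : Tor M),
      0 ≤ ind (g := unitTorusGeo L K M) ((cubeBlocks M (coverCorner M (L ^ s) (L ^ (mT - s)) (coverMargin L s) k) (L ^ (s + 1)) : Finset (Tor M)) : Set (Tor M)) y *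
        ind (g := unitTorusGeo L K M) ((cubeBlocks M (coverCorner M (L ^ s) (L ^ (mT - s)) (coverMargin L s) k) (L ^ (s + 1)) : Finset (Tor M)) : Set (Tor M)) y' :=
    fun k y y' => mul_nonneg (ind_nonneg _ _) (ind_nonneg _ _)
  -- the cut rows at the fine spacing, rate weakened to `δ`
  have hGc' : ∀ k : Fin (d + 1) → ZMod (2 * L ^ (mT - s)),
      HasMaj (BlockNorm.ofBlocks (unitTorusGeo L K M) (fun i : Tor (fine (L ^ r * L ^ K) M) × Fin (d + 1) => blockOf (L ^ r * L ^ K) M i.1))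
        (BlockNorm.ofBlocks (unitTorusGeo L K M) (fun i : Tor (fine (L ^ r * L ^ K) M) × Fin (d + 1) => blockOf (L ^ r * L ^ K) M i.1))
        (mulOp (chiCube M (L ^ r * L ^ K) (coverCorner M (L ^ s) (L ^ (mT - s)) (coverMargin L s) k) (L ^ (s + 1))) ∘ₗ knitGR d L s mT K (L ^ r * L ^ K) hL hs a k)
        (fun y y' => ind ((cubeBlocks M (coverCorner M (L ^ s) (L ^ (mT - s)) (coverMargin L s) k) (L ^ (s + 1)) : Finset (Tor M)) : Set (Tor M)) y *
          ind ((cubeBlocks M (coverCorner M (L ^ s) (L ^ (mT - s)) (coverMargin L s) k) (L ^ (s + 1)) : Finset (Tor M)) : Set (Tor M)) y' * (C * Real.exp (-(δ * tdistT M y y')))) := fun k =>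
    hasMaj_rate_le (hind k) hC.le (min_le_left _ _) (HG' (s + 1) mT K r hs hK (coverCorner M (L ^ s) (L ^ (mT - s)) (coverMargin L s) k))
  have hDGc' : ∀ k : Fin (d + 1) → ZMod (2 * L ^ (mT - s)),
      HasMaj (BlockNorm.ofBlocks (unitTorusGeo L K M) (fun i : Tor (fine (L ^ r * L ^ K) M) × Fin (d + 1) => blockOf (L ^ r * L ^ K) M i.1))
        (BlockNorm.ofBlocks (unitTorusGeo L K M) (fun i : Tor (fine (L ^ r * L ^ K) M) × Fin (d + 1) => blockOf (L ^ r * L ^ K) M i.1))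
        (mulOp (chiCube M (L ^ r * L ^ K) (coverCorner M (L ^ s) (L ^ (mT - s)) (coverMargin L s) k) (L ^ (s + 1))) ∘ₗ
          (fgrad ((L ^ r * L ^ K : ℕ) : ℝ) (bshiftEquiv M (L ^ r * L ^ K) μ) ∘ₗ knitGR d L s mT K (L ^ r * L ^ K) hL hs a k))
        (fun y y' => ind ((cubeBlocks M (coverCorner M (L ^ s) (L ^ (mT - s)) (coverMargin L s) k) (L ^ (s + 1)) : Finset (Tor M)) : Set (Tor M)) y *
          ind ((cubeBlocks M (coverCorner M (L ^ s) (L ^ (mT - s)) (coverMargin L s) k) (L ^ (s + 1)) : Finset (Tor M)) : Set (Tor M)) y' * (βD * Real.exp (-(δ * tdistT M y y')))) :=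
    fun k => by
    have h := HD (s + 1) mT K r hs hK (coverCorner M (L ^ s) (L ^ (mT - s)) (coverMargin L s) k) μ
    rw [symbOp_sD_eq] at h
    exact hasMaj_rate_le (hind k) hβD.le (min_le_right _ _) h
  -- the partition: Leibniz, cuts, sizes, overlap
  have hχ' := fun ν k => chiCube_coverCorner_eq_one_side (M := M) (n := L ^ r * L ^ K) (m₀ := coverMargin L s) hM hw hfit1 hS ν k
  have hleib : ∀ k : Fin (d + 1) → ZMod (2 * L ^ (mT - s)), fgrad ((L ^ r * L ^ K : ℕ) : ℝ) (bshiftEquiv M (L ^ r * L ^ K) μ) ∘ₗ mulOp (knitHR d L s mT K (L ^ r * L ^ K) hL k) =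
      mulOp (knitHR d L s mT K (L ^ r * L ^ K) hL k ∘ ⇑(bshiftEquiv M (L ^ r * L ^ K) μ)) ∘ₗ fgrad ((L ^ r * L ^ K : ℕ) : ℝ) (bshiftEquiv M (L ^ r * L ^ K) μ) +
        mulOp (fgrad ((L ^ r * L ^ K : ℕ) : ℝ) (bshiftEquiv M (L ^ r * L ^ K) μ) (knitHR d L s mT K (L ^ r * L ^ K) hL k)) := fun k => fgrad_comp_mulOp _ _ _
  have hcuts := fun k : Fin (d + 1) → ZMod (2 * L ^ (mT - s)) => coverH_shift_cut (n := L ^ r * L ^ K) (m₀ := coverMargin L s) hM hw hfit1 hS μ k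
  have hcutd := fun k : Fin (d + 1) → ZMod (2 * L ^ (mT - s)) =>
    fgrad_hcube_cut (2 * L ^ (mT - s)) (coverXi M (L ^ r * L ^ K) (L ^ s)) (bshiftEquiv M (L ^ r * L ^ K)) μ ((L ^ r * L ^ K : ℕ) : ℝ) (hχ' μ k)
  have hh : ∀ (k : Fin (d + 1) → ZMod (2 * L ^ (mT - s))) x, |knitHR d L s mT K (L ^ r * L ^ K) hL k x| ≤ 1 := fun k x => abs_coverH_le_one k x
  have hhs : ∀ (k : Fin (d + 1) → ZMod (2 * L ^ (mT - s))) x, |(knitHR d L s mT K (L ^ r * L ^ K) hL k ∘ ⇑(bshiftEquiv M (L ^ r * L ^ K) μ)) x| ≤ 1 :=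
    fun k x => abs_coverH_le_one k (bshiftEquiv M (L ^ r * L ^ K) μ x)
  have hdh : ∀ (k : Fin (d + 1) → ZMod (2 * L ^ (mT - s))) x, |fgrad ((L ^ r * L ^ K : ℕ) : ℝ) (bshiftEquiv M (L ^ r * L ^ K) μ) (knitHR d L s mT K (L ^ r * L ^ K) hL k) x| ≤
      π / ((L ^ s : ℕ) : ℝ) := fun k x => abs_fgrad_coverH_le hM hw k μ x
  have hN : ∀ y : Tor M, ∑ k : Fin (d + 1) → ZMod (2 * L ^ (mT - s)),
      ind (g := unitTorusGeo L K M) ((cubeBlocks M (coverCorner M (L ^ s) (L ^ (mT - s)) (coverMargin L s) k) (L ^ (s + 1)) : Finset _) : Set _) y ≤ Nov := fun y => by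
    have h := sum_ind_cubeBlocks_le_overlap (S := L ^ (s + 1)) (m₀ := coverMargin L s) hM hw L K y
    rw [hdiv] at h
    exact h
  -- FILE 83
  have key := hasMaj_comp_parametrix_cut (g := unitTorusGeo L K M) (fun i : Tor (fine (L ^ r * L ^ K) M) × Fin (d + 1) => blockOf (L ^ r * L ^ K) M i.1)
    (fun k => ((cubeBlocks M (coverCorner M (L ^ s) (L ^ (mT - s)) (coverMargin L s) k) (L ^ (s + 1)) : Finset (Tor M)) : Set (Tor M))) hC.le hβD.le zero_le_one
    (by positivity : (0 : ℝ) ≤ π / ((L ^ s : ℕ) : ℝ)) hleib hcuts hcutd hh hhs hdh hN hGc' hDGc'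
  refine key.mono fun y y' => mul_le_mul_of_nonneg_right ?_ (Real.exp_nonneg _)
  have hπw : π / ((L ^ s : ℕ) : ℝ) * C ≤ π * C := mul_le_mul_of_nonneg_right (div_le_self Real.pi_pos.le hwR) hC.le
  have h2 : Nov * (1 * βD + π / ((L ^ s : ℕ) : ℝ) * C) ≤ Nov * (1 * βD + π * C) := mul_le_mul_of_nonneg_left (by linarith) (by positivity)
  linarith

end Record

end Summit.QuantumFields.YangMills.BalabanUVNodes.N15.Gluing

end
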